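import Summits.CriticalPhenomena.Ising3DConformalLimit.Theorems.PrecisionLaplacianDirectCorrelationStableTailSlabModeExpDecayGreenTransferAux2
import Summits.CriticalPhenomena.Ising3DConformalLimit.Theorems.PrecisionLaplacianDirectCorrelationStableTailSlabModeExpDecayGreenTransferAux3
import Summits.CriticalPhenomena.Ising3DConformalLimit.Theorems.PrecisionLaplacianDirectCorrelationStableTailSlabSpectralRepresentation

/-!
# Brick `stub_slabModeExpDecay_auxGreenTransfer` of stub `stub_slabModeExpDecay` (line
# `self-energy-pick-inversion`, crux `PrecisionLaplacian.DirectCorrelationStableTail`, stmt-CriticalPhenomena-4799):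
# the LOSSLESS Green-to-direct-correlation transfer of the transverse mass gap

**Statement** (registered sub-stub `stub_slabModeExpDecay_auxGreenTransfer`; package form
`H → HypG → HasSlabModeExpDecay dcf`). Let `G = criticalTwoPoint 3` satisfy `H` (every kernel matrix
`M_A = (G(q - p))_{p,q ∈ A}` is a symmetric potential), let `a = dcf` be its direct correlation function
(`a(x) = inf_A -(M_A)⁻¹(0, x)`), `A₀ = lim_n (M_{Λ_n})⁻¹(0, 0)` along the centred boxes `Λ_n`
(`EtaBoundsTransfer.exists_A0`) and `q = 𝟙_{≠ 0} a / A₀` the sub-stochastic step law of the walk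
dictionary `A₀ G = δ₀ + q ∗ (A₀ G)` (`EtaBoundsTransfer.limit_equation`). HYPOTHESIS `HypG` (the G-side
transverse mass gap `m(k) ≥ c‖k‖`, sharp-momentum form): there is `c > 0` such that for every direction
`i`, every GOOD transverse momentum `k` (`|k_j| < π`, some `k_j ≠ 0`) and every rate `c' ∈ (0, c)`, the
G-side slab transforms `h⁽ⁱ⁾_n(k) = ∫_{-π}^{π} cos(nθ) (1 - φ(ins_i(θ, k)))⁻¹ dθ`,
`φ(p) = ∑_x q(x) cos(p·x)` — exactly the objects of `stub_pickInversion_auxGoodMomentum` — are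
eventually `≤ C e^{-c'‖k‖ n}`. CONCLUSION: `HasSlabModeExpDecay dcf` (expanded verbatim as in
`stub_slabModeExpDecay`) WITH THE SAME `c`.

**Proof.** At a good momentum `k`, `(h_n(k))_n` are the moments of a finite measure `μ_k` on `[0, 1]`
(`slabMoments_of_openCube`); the decay makes `μ_k` carried by `[0, e^{-c'‖k‖}]` (rigidity,
`Literature.MeasureTheory.Moments`); the lever WITH SUPPORT (`hausdorff_support_slabModes_of_good`,
file `…GreenTransferAux2`: the Nevanlinna measure of `-1/F` does not charge the interval below the cut of
the Poisson transform `F` of `μ_k` — weak Stieltjes inversion below a threshold, file `…GreenTransferAux`)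
gives the a-side representing measure `τ_k` carried by the same interval, i.e. the gap inequality
`â_{n+1}(k) ≤ e^{-c'‖k‖} â_n(k)` (`n ≥ 1`) for the slab modes of `a`. Continuity and periodicity in `k`
carry the gap inequality to the whole reduced zone (file `…GreenTransferAux3`), and the gap gives the
decay `â_n(k) ≤ â_1(k) e^{c'‖k‖} e^{-c'‖k‖ n}`.

**Use.** With this brick the parent stub `stub_slabModeExpDecay`
(`H → Summable dcf → IsSlabHausdorff dcf → HasSlabModeExpDecay dcf`) reduces to the purely G-side
implication `H → HypG` — a lattice spectrum condition `m(k) ≥ c‖k‖_∞` for the `σ`-odd transfer-matrix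
sector at transverse momentum `k` (necessarily `c < 1`: the massless Gaussian value is `arccosh 3 / π`).
References: Akhiezer, *The classical moment problem*, Ch. 3; Donoghue (1974), Ch. II;
Aizenman–Duminil-Copin (2021), §8.
-/

noncomputable section

namespace Summit.CriticalPhenomena.Ising3DConformalLimit.Cruxes.DirectCorrelationStableTail.SelfEnergyPickInversion

open MeasureTheory Filter Topology Finset Real Literature.Probability.LatticeModels
open scoped BigOperators
open Literature.MeasureTheory.Moments
open Summit.CriticalPhenomena.Ising3DConformalLimit.Theorems.EtaBoundsTransfer
  (exists_A0 limit_equation summable_a a_nonneg a_neg continuous_phase continuous_fourier_q)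

/-! ### The gap inequality at a good transverse momentum -/

/-- **The gap at a good transverse momentum.** For the Green function `G = ∑ⱼ q^{∗j}` of an even
sub-stochastic step law `q` on `ℤ³` (positive at the unit vectors, slab quadratic forms Hausdorff,
`q` symmetric under the reflection of the `i`-th coordinate), at a good transverse momentum `k₀`:
if the slab transforms `h_n(k₀)` are eventually `≤ C θⁿ` with `0 < θ < 1`, then the slab modes
`αₙ = ∑_y q(ins_i(n, y)) cos(k₀·y)` satisfy `α_{n+1} ≤ θ αₙ` for all `n ≥ 1`. [folklore] -/
theorem slabModes_succ_le_of_good {q : Site 3 → ℝ} {P : ℕ → Site 3 → ℝ} {G : Site 3 → ℝ}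
    (hq0 : ∀ y, 0 ≤ q y) (hqs : Summable q) (hq1 : ∑' y, q y ≤ 1) (hqev : ∀ y, q (-y) = q y)
    (hP0 : ∀ z, P 0 z = if z = 0 then 1 else 0) (hPs : ∀ j z, P (j + 1) z = ∑' y, q y * P j (z - y))
    (hGreen : ∀ z, HasSum (fun j => P j z) (G z)) (hGpos : ∀ m : Fin 3, 0 < G (Pi.single m 1))
    (i : Fin 3) (hqrefl : ∀ y : Site 3, q (Function.update y i (-y i)) = q y)
    (hHS : ∀ (s : Finset (Fin 2 → ℤ)) (v : (Fin 2 → ℤ) → ℝ), ∃ μ : Measure ℝ, IsFiniteMeasure μ ∧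
      μ (Set.Icc (0 : ℝ) 1)ᶜ = 0 ∧ ∀ n : ℕ,
        ∑ x ∈ s, ∑ y ∈ s, v x * v y * G (Fin.insertNth i (n : ℤ) (x - y) : Site 3) = ∫ t, t ^ n ∂μ)
    {k₀ : Fin 2 → ℝ} (hk₀ : ∀ j, |k₀ j| < π) (hne : ∃ j, k₀ j ≠ 0) {θ : ℝ} (hθ₀ : 0 < θ) (hθ₁ : θ < 1)
    (hdecay : ∃ C : ℝ, ∀ᶠ n : ℕ in atTop, ∫ θ' in (-π)..π, Real.cos (n * θ') /
      (1 - ∑' x : Site 3, q x * Real.cos (phase 3 (Fin.insertNth i θ' k₀ : Fin 3 → ℝ) x)) ≤ C * θ ^ n)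
    (n : ℕ) (hn : 1 ≤ n) :
    ∑' y : Fin 2 → ℤ, q (Fin.insertNth i ((n + 1 : ℕ) : ℤ) y) * Real.cos (phase 2 k₀ y) ≤
      θ * ∑' y : Fin 2 → ℤ, q (Fin.insertNth i (n : ℤ) y) * Real.cos (phase 2 k₀ y) := by
  obtain ⟨hlt, μ₀, hμ₀fin, hμ₀0, hμ₀mom⟩ :=
    slabMoments_of_openCube hq0 hqs hq1 hqev hP0 hPs hGreen hGpos i hHS hk₀ hne
  haveI := hμ₀fin
  obtain ⟨C, hC⟩ := hdecay
  have hμθ : μ₀ (Set.Ioi θ) = 0 :=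
    measure_Ioi_eq_zero_of_eventually_integral_pow_le μ₀ hμ₀0 θ C hθ₀.le
      (hC.mono fun n hn => by rwa [hμ₀mom n] at hn)
  obtain ⟨τ, hτfin, hτ0, hτθ, hτmom⟩ :=
    hausdorff_support_slabModes_of_good hq0 hqs i hqrefl k₀ hlt hμ₀0 hθ₀ hθ₁ hμθ hμ₀mom
  haveI := hτfin
  exact hausdorffSeq_succ_le_mul_of_measure_Ioi_eq_zero
    (fun n : ℕ => ∑' y : Fin 2 → ℤ, q (Fin.insertNth i (n : ℤ) y) * Real.cos (phase 2 k₀ y)) τ hτ0 hτmom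
    θ hτθ n hn

/-! ### The brick -/

/-- **Registered sub-stub `stub_slabModeExpDecay_auxGreenTransfer`** (brick of `stub_slabModeExpDecay`;
package form `IsSymmPotentialKernel (criticalTwoPoint 3) → HypG → HasSlabModeExpDecay dcf`, conclusion
EXPANDED verbatim as in `stub_slabModeExpDecay`). `HypG` quantifies over the limit
`A₀ = lim_n (M_{Λ_n})⁻¹(0,0)` through its defining properties as produced by `EtaBoundsTransfer.exists_A0`
(convergence along the centred boxes, domination of the box values, positivity) and asks, for some `c > 0`,
every direction `i`, every good transverse momentum `k` and every rate `c' ∈ (0, c)`, for the eventual bound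
`∫_{-π}^{π} cos(nθ) / (1 - ∑_x (𝟙_{x ≠ 0} dcf(x)/A₀) cos(ins_i(θ, k)·x)) dθ ≤ C e^{-c'‖k‖ n}` — the G-side
transverse mass gap in the sharp-momentum form of `stub_pickInversion_auxGoodMomentum`. The transfer to
the a-side is LOSSLESS: the conclusion holds with the same `c`. See the module docstring. [folklore] -/
theorem stub_slabModeExpDecay_auxGreenTransfer :
    (∀ A : Finset (Site 3), (Matrix.of fun (p q : ↥A) => criticalTwoPoint 3 (q.1 - p.1)).PosDef ∧ ∀ u v :
      ↥A, (u ≠ v → (Matrix.of fun (p q : ↥A) => criticalTwoPoint 3 (q.1 - p.1))⁻¹ u v ≤ 0) ∧ 0 ≤ ∑ w,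
      (Matrix.of fun (p q : ↥A) => criticalTwoPoint 3 (q.1 - p.1))⁻¹ u w) →
    (∃ c : ℝ, 0 < c ∧ ∀ A₀ : ℝ,
      Filter.Tendsto (fun n : ℕ => (Matrix.of fun (p q : ↥(box 3 n)) => criticalTwoPoint 3 (q.1 - p.1))⁻¹
        ⟨0, zero_mem_box 3 n⟩ ⟨0, zero_mem_box 3 n⟩) Filter.atTop (nhds A₀) →
      (∀ n : ℕ, (Matrix.of fun (p q : ↥(box 3 n)) => criticalTwoPoint 3 (q.1 - p.1))⁻¹
        ⟨0, zero_mem_box 3 n⟩ ⟨0, zero_mem_box 3 n⟩ ≤ A₀) → 0 < A₀ →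
      ∀ (i : Fin 3) (k : Fin 2 → ℝ), (∀ j, |k j| < Real.pi) → (∃ j, k j ≠ 0) → ∀ c' : ℝ, 0 < c' → c' < c →
        ∃ C : ℝ, ∀ᶠ n : ℕ in Filter.atTop,
          (∫ θ in (-Real.pi)..Real.pi, Real.cos (n * θ) / (1 - ∑' x : Site 3,
            (if x = 0 then (0 : ℝ) else (⨅ A : {A : Finset (Site 3) // (0 : Site 3) ∈ A ∧ x ∈ A},
              -((Matrix.of fun (p q : ↥A.1) => criticalTwoPoint 3 (q.1 - p.1))⁻¹ ⟨0, A.2.1⟩ ⟨x, A.2.2⟩))) / A₀ *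
            Real.cos (∑ j, (Fin.insertNth i θ k : Fin 3 → ℝ) j * ((x j : ℤ) : ℝ)))) ≤
          C * Real.exp (-(c' * ‖k‖ * (n : ℝ)))) →
    (∃ c : ℝ, 0 < c ∧ ∀ (i : Fin 3) (k : Fin 2 → ℝ), (∀ j, |k j| ≤ Real.pi) → ∀ c' : ℝ, 0 < c' → c' < c → ∃
      C : ℝ, ∀ᶠ n : ℕ in Filter.atTop, (∑' y : Fin 2 → ℤ, (⨅ A : {A : Finset (Site 3) // (0 : Site 3) ∈ A ∧
      (Fin.insertNth i (n : ℤ) (y) : Site 3) ∈ A}, -((Matrix.of fun (p q : ↥A.1) => criticalTwoPoint 3 (q.1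
      - p.1))⁻¹ ⟨0, A.2.1⟩ ⟨(Fin.insertNth i (n : ℤ) (y) : Site 3), A.2.2⟩)) * Real.cos (∑ j, k j * (y j :
      ℝ))) ≤ C * Real.exp (-(c' * ‖k‖ * (n : ℝ)))) := by
  intro hH hyp
  obtain ⟨c, hc, hdec⟩ := hyp
  classical
  have hπ := Real.pi_pos
  -- adapted from `stub_pickInversion` (file `…PickInversion`): the walk dictionary of `EtaBoundsTransfer`
  set M : (A : Finset (Site 3)) → Matrix ↥A ↥A ℝ :=
    fun A => Matrix.of fun (p q : ↥A) => criticalTwoPoint 3 (q.1 - p.1) with hMdef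
  have hM : ∀ A, M A = Matrix.of fun (p q : ↥A) => criticalTwoPoint 3 (q.1 - p.1) := fun A => rfl
  have hSP : ∀ A : Finset (Site 3), (M A).PosDef ∧
      ∀ u v : ↥A, (u ≠ v → (M A)⁻¹ u v ≤ 0) ∧ 0 ≤ ∑ w, (M A)⁻¹ u w := hH
  set kk : ℕ → ℝ := fun n => (M (box 3 n))⁻¹ ⟨0, zero_mem_box 3 n⟩ ⟨0, zero_mem_box 3 n⟩ with hkkdef
  have hk : ∀ n, kk n = (M (box 3 n))⁻¹ ⟨0, zero_mem_box 3 n⟩ ⟨0, zero_mem_box 3 n⟩ := fun n => rfl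
  set tt : ℕ → Site 3 → ℝ := fun n y =>
    if hy : y ∈ box 3 n then -(M (box 3 n))⁻¹ ⟨0, zero_mem_box 3 n⟩ ⟨y, hy⟩ else 0 with httdef
  have ht : ∀ n y (hy : y ∈ box 3 n), tt n y = -(M (box 3 n))⁻¹ ⟨0, zero_mem_box 3 n⟩ ⟨y, hy⟩ :=
    fun n y hy => by simp only [httdef, dif_pos hy]
  set a : Site 3 → ℝ := fun y => ⨅ A : {A : Finset (Site 3) // (0 : Site 3) ∈ A ∧ y ∈ A},
    -((M A.1)⁻¹ ⟨0, A.2.1⟩ ⟨y, A.2.2⟩) with hadef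
  have ha : ∀ y, a y = ⨅ A : {A : Finset (Site 3) // (0 : Site 3) ∈ A ∧ y ∈ A},
      -((M A.1)⁻¹ ⟨0, A.2.1⟩ ⟨y, A.2.2⟩) := fun y => rfl
  have hGto : Tendsto (criticalTwoPoint 3) cofinite (𝓝 0) := criticalTwoPoint_tendsto_zero_cofinite
  obtain ⟨A₀, hkA, hkle, hA0⟩ := exists_A0 hM hSP hGto hk
  have heq : ∀ z, A₀ * criticalTwoPoint 3 z - ∑' y, (if y = 0 then 0 else a y) * criticalTwoPoint 3 (z - y) =
      if z = 0 then 1 else 0 := fun z => limit_equation hM hSP hGto hk ht ha hkA hkle z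
  obtain ⟨hsa, hsale⟩ := summable_a hSP hk ht ha hkle
  have ha0 : ∀ y, y ≠ 0 → 0 ≤ a y := fun y hy => a_nonneg hSP ha hy
  have haev : ∀ y, y ≠ 0 → a (-y) = a y := fun y hy => a_neg hM hSP ht ha hy
  have harefl : ∀ (i : Fin 3) (y : Site 3), y ≠ 0 → a (Function.update y i (-y i)) = a y :=
    fun i y hy => a_reflect hM hSP ht ha i (criticalTwoPoint_reflect i) hy
  -- the normalised step law `q = a'/A₀` and Green function `G' = A₀ G`
  set a' : Site 3 → ℝ := fun y => if y = 0 then 0 else a y with ha'def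
  set q : Site 3 → ℝ := fun y => a' y / A₀ with hqdef
  set G' : Site 3 → ℝ := fun z => A₀ * criticalTwoPoint 3 z with hG'def
  have ha'0 : ∀ y, 0 ≤ a' y := fun y => by
    simp only [ha'def]; split_ifs with hy
    · exact le_rfl
    · exact ha0 y hy
  have hq0 : ∀ y, 0 ≤ q y := fun y => div_nonneg (ha'0 y) hA0.le
  have hqs : Summable q := hsa.div_const A₀
  have hq1 : ∑' y, q y ≤ 1 := by
    simp only [hqdef]; rw [tsum_div_const]; exact (div_le_one hA0).2 hsale
  have hq00 : q 0 = 0 := by simp [hqdef, ha'def]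
  have hqev : ∀ y, q (-y) = q y := by
    intro y
    by_cases hy : y = 0
    · subst hy; simp
    · simp only [hqdef, ha'def, neg_eq_zero, if_neg hy, haev y hy]
  have hR0 : ∀ (i : Fin 3) (y : Site 3), Function.update y i (-y i) = 0 ↔ y = 0 := by
    intro i y
    constructor
    · intro h; ext j
      have hj := congrFun h j
      by_cases hji : j = i
      · subst hji; simpa using hj
      · rwa [Function.update_of_ne hji] at hj
    · rintro rfl; ext j; by_cases hji : j = i
      · subst hji; simp
      · simp [Function.update_of_ne hji]
  have hqrefl : ∀ (i : Fin 3) (y : Site 3), q (Function.update y i (-y i)) = q y := by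
    intro i y
    by_cases hy : y = 0
    · rw [hy, (hR0 i 0).2 rfl]
    · have hy' : Function.update y i (-y i) ≠ 0 := fun h => hy ((hR0 i y).1 h)
      simp only [hqdef, ha'def, if_neg hy, if_neg hy', harefl i y hy]
  have hG'0 : ∀ z, 0 ≤ G' z := fun z => mul_nonneg hA0.le (criticalTwoPoint_nonneg' z)
  have hG'C : ∀ z, G' z ≤ A₀ := fun z => by
    have := mul_le_mul_of_nonneg_left (criticalTwoPoint_le_one' (d := 3) z) hA0.le
    simpa [hG'def] using this
  have hG'to : Tendsto G' cofinite (𝓝 0) := by simpa [hG'def] using hGto.const_mul A₀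
  have hG'eq : ∀ z, G' z = (if z = 0 then 1 else 0) + ∑' y, q y * G' (z - y) := by
    intro z
    have h1 : ∑' y, q y * G' (z - y) = ∑' y, a' y * criticalTwoPoint 3 (z - y) :=
      tsum_congr fun y => by simp only [hqdef, hG'def]; field_simp
    rw [h1, ← heq z]; simp only [hG'def, ha'def]; ring
  -- convolution powers and the Green series
  set P : ℕ → Site 3 → ℝ := fun j => Nat.rec (fun z => if z = 0 then (1 : ℝ) else 0)
    (fun _ Pj z => ∑' y, q y * Pj (z - y)) j with hPdef
  have hP0 : ∀ z, P 0 z = if z = 0 then 1 else 0 := fun z => rfl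
  have hPs : ∀ j z, P (j + 1) z = ∑' y, q y * P j (z - y) := fun j z => rfl
  have hGreen : ∀ z, HasSum (fun j => P j z) (G' z) :=
    hasSum_convPow_of_green_equation hq0 hqs hq1 hq00 hP0 hPs hG'0 hG'C hG'to hG'eq
  have hGpos : ∀ m : Fin 3, 0 < G' (Pi.single m 1) := fun m => mul_pos hA0 (criticalTwoPoint_single_pos m)
  -- slab quadratic forms of `G'` (stub 1, landed)
  have hHS : ∀ (i : Fin 3) (s : Finset (Fin 2 → ℤ)) (v : (Fin 2 → ℤ) → ℝ), ∃ μ : Measure ℝ, IsFiniteMeasure μ ∧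
      μ (Set.Icc (0 : ℝ) 1)ᶜ = 0 ∧ ∀ n : ℕ,
        ∑ x ∈ s, ∑ y ∈ s, v x * v y * G' (Fin.insertNth i (n : ℤ) (x - y) : Site 3) = ∫ t, t ^ n ∂μ := by
    intro i s v
    obtain ⟨μ, hμfin, hμ0, hμmom⟩ := stub_slabSpectralRepresentation i s v
    refine ⟨A₀.toNNReal • μ, inferInstance, by rw [Measure.smul_apply, hμ0, smul_zero], fun n => ?_⟩
    rw [integral_smul_nnreal_measure, ← hμmom n, NNReal.smul_def, smul_eq_mul, Real.coe_toNNReal _ hA0.le,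
      Finset.mul_sum]
    refine Finset.sum_congr rfl fun x _ => ?_
    rw [Finset.mul_sum]
    refine Finset.sum_congr rfl fun y _ => ?_
    simp only [hG'def]; ring
  -- the G-side decay hypothesis at `A₀`
  have hdecA := hdec A₀ hkA hkle hA0
  refine ⟨c, hc, fun i k hk c' hc' hc'c => ?_⟩
  -- the gap inequality at good momenta
  set F : ℕ → (Fin 2 → ℝ) → ℝ := fun n k => ∑' y : Fin 2 → ℤ, a (Fin.insertNth i (n : ℤ) y) * Real.cos (phase 2 k y)
    with hFdef
  have hFq : ∀ (n : ℕ) (k : Fin 2 → ℝ), 1 ≤ n →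
      F n k = A₀ * ∑' y : Fin 2 → ℤ, q (Fin.insertNth i (n : ℤ) y) * Real.cos (phase 2 k y) := by
    intro n k hn
    rw [← tsum_mul_left]
    refine tsum_congr fun y => ?_
    have hne0 := insertNth_ne_zero i (n := (n : ℤ)) (by exact_mod_cast (by omega : n ≠ 0)) y
    simp only [hqdef, ha'def, if_neg hne0]
    field_simp
  have hgood : ∀ k₀ : Fin 2 → ℝ, (∀ j, |k₀ j| < π) → (∃ j, k₀ j ≠ 0) → ∀ n : ℕ, 1 ≤ n →
      F (n + 1) k₀ ≤ Real.exp (-(c' * ‖k₀‖)) * F n k₀ := by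
    intro k₀ hk₀ hne n hn
    have hk₀0 : k₀ ≠ 0 := by
      obtain ⟨j, hj⟩ := hne
      intro h; exact hj (by simp [h])
    have hθ₀ : 0 < Real.exp (-(c' * ‖k₀‖)) := Real.exp_pos _
    have hθ₁ : Real.exp (-(c' * ‖k₀‖)) < 1 := by
      rw [Real.exp_lt_one_iff]
      exact neg_lt_zero.2 (mul_pos hc' (norm_pos_iff.2 hk₀0))
    have hdecay : ∃ C : ℝ, ∀ᶠ n : ℕ in atTop, ∫ θ' in (-π)..π, Real.cos (n * θ') /
        (1 - ∑' x : Site 3, q x * Real.cos (phase 3 (Fin.insertNth i θ' k₀ : Fin 3 → ℝ) x)) ≤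
          C * Real.exp (-(c' * ‖k₀‖)) ^ n := by
      obtain ⟨C, hC⟩ := hdecA i k₀ hk₀ hne c' hc' hc'c
      refine ⟨C, hC.mono fun n hn => ?_⟩
      have hpow : Real.exp (-(c' * ‖k₀‖ * (n : ℝ))) = Real.exp (-(c' * ‖k₀‖)) ^ n := by
        rw [← Real.exp_nat_mul]; ring_nf
      rw [hpow] at hn
      simpa only [phase, hqdef, ha'def, hadef, hMdef] using hn
    have h := slabModes_succ_le_of_good hq0 hqs hq1 hqev hP0 hPs hGreen hGpos i (hqrefl i) (hHS i) hk₀ hne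
      hθ₀ hθ₁ hdecay n hn
    rw [hFq (n + 1) k₀ (by omega), hFq n k₀ hn, mul_left_comm]
    exact mul_le_mul_of_nonneg_left h hA0.le
  -- continuity and periodicity of the slab modes of `a`
  have hcontF : ∀ n, 1 ≤ n → Continuous (F n) := by
    intro n hn
    have hne0 : ∀ y, (Fin.insertNth i (n : ℤ) y : Site 3) ≠ 0 := fun y =>
      insertNth_ne_zero i (n := (n : ℤ)) (by exact_mod_cast (by omega : n ≠ 0)) y
    have heqa : (fun y : Fin 2 → ℤ => a (Fin.insertNth i (n : ℤ) y)) = fun y => a' (Fin.insertNth i (n : ℤ) y) := by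
      funext y; simp only [ha'def, if_neg (hne0 y)]
    have hs : Summable fun y : Fin 2 → ℤ => a (Fin.insertNth i (n : ℤ) y) := by
      rw [heqa]; exact hsa.comp_injective (insertNth_right_injective i n)
    simp only [hFdef]
    refine continuous_tsum (fun y => ?_) hs fun y k => ?_
    · have := continuous_phase (d := 2) y; fun_prop
    · rw [Real.norm_eq_abs, abs_mul, abs_of_nonneg (ha0 _ (hne0 y))]
      exact mul_le_of_le_one_right (ha0 _ (hne0 y)) (Real.abs_cos_le_one _)
  have hperF : ∀ (n : ℕ) (k' : Fin 2 → ℝ) (m : Fin 2 → ℤ), F n (fun j => k' j + (m j : ℝ) * (2 * π)) = F n k' :=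
    fun n k' m => tsum_mul_cos_periodic (fun y : Fin 2 → ℤ => a (Fin.insertNth i (n : ℤ) y)) k' m
  -- the gap on the whole reduced zone, and the decay
  have hgap : ∀ n : ℕ, 1 ≤ n → F (n + 1) k ≤ Real.exp (-(c' * ‖k‖)) * F n k :=
    fun n hn => gap_of_gap_at_good_momenta hcontF hperF c' hgood k hk n hn
  have hdecayF := seq_le_mul_pow_of_succ_le_mul (fun n => F n k) (Real.exp (-(c' * ‖k‖))) (Real.exp_nonneg _) hgap
  refine ⟨F 1 k * Real.exp (c' * ‖k‖), eventually_atTop.2 ⟨1, fun n hn => ?_⟩⟩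
  have h := hdecayF n hn
  have hpow : Real.exp (-(c' * ‖k‖)) ^ (n - 1) = Real.exp (c' * ‖k‖) * Real.exp (-(c' * ‖k‖ * (n : ℝ))) := by
    rw [← Real.exp_nat_mul, ← Real.exp_add, Nat.cast_sub hn, Nat.cast_one]; ring_nf
  rw [hpow, ← mul_assoc] at h
  simpa only [hFdef, phase] using h

end Summit.CriticalPhenomena.Ising3DConformalLimit.Cruxes.DirectCorrelationStableTail.SelfEnergyPickInversion

end
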